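import Literature.AlgebraicGeometry.Frobenioids.Prop41SchemaNegativePrelim
import HarnessLib

/-!
# Frobenioids I, Prop. 4.1 (i), (iv), (v) as the schemata `PreFrobenioidData.Prop41i S A α`,
# `Prop41iv S`, `Prop41v S`: the universal closures over ARBITRARY operations `S` are false
# (FACT-LIST F-1038 · F-1042 · F-1043)

Mochizuki, *The geometry of Frobenioids I: the general theory*, Kyushu J. Math. **62** (2008) 293–400,
§4, Proposition 4.1 (i) p. 75, (iv)/(v) p. 76: "(i) `φ` is primary if and only if the following
condition is satisfied: … there exist `n ∈ N_{≥1}`, `β'` of Frobenius type, a pre-step `ζ'` such that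
`α_n ∘ φ_A = (φ ∘ ζ') ∘ β'`"; "(iv) `δ` is primary if and only if … there exists `𝔭 ∈ Prime(Φ(F))` such
that [for the primary `ε'` avoiding `𝔭`] the two conditions `ε = ε' ∘ ζ`, `ε ∘ δ = ε' ∘ θ` are
equivalent"; (v) dually with `𝔭 ∈ Prime(Φ(D'))` [cite: MochizukiFrdI2008, Prop. 4.1 p.75].

PROOF-ONLY companion (no definitions, no instances) of `DivisorMonoidCategoryTheoreticityDefs.lean`
(seat abc-iut-L1-t3); cell abc-iut, block F, seat abc-iut-f-045 (gen 4).  FACT-LIST rows **F-1038**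
`PreFrobenioidData.Prop41i`, **F-1042** `Prop41iv`, **F-1043** `Prop41v` (R7 TYPE-audit abc-iut-w5-d199:
«no EXACT witness of the universal closure»).  The decls quantify over ARBITRARY operations
`S : PreFrobenioidData C D` (an interface carrying `Base`, `Φ`, `Div`, `deg_Fr` and the laws of
Rem. 1.1.1 only — no axiom of Def. 1.3), and over such data the printed conclusions fail.
WITNESS (Model A, `exists_prop41DiagonalConeData`, built on the toolkit `Prop41SchemaNegativePrelim.lean`):
the one-object category `SingleObj F_{ℚ_{≥0}}` (`F_M` of Def. 1.1 (iii)) with DECLARED divisor monoid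
`Φ = ℚ_{≥0}²`, `Div(a, n) = (a, a)`, `deg_Fr(a, n) = n`, trivial pull-backs, base `pt` — of perfect and
isotropic type, with steps, the Prop. 4.1 setting holding at its object with `α_n = (0, n)` — in which NO
step is primary (`(a, a)`, `a > 0`, is not primary in `ℚ_{≥0}²`) although `Prime(Φ) ≠ ∅` (`(1, 0)` is
primary).  Hence: (iv)/(v) — for the non-primary step `δ = ε = (1, 1)` the right-hand side holds
VACUOUSLY at any prime (there is no primary `ε'`/`δ'`), the left-hand side fails; (i) — for the
non-primary step `φ = (1, 1)` every factorisation `φ = φ_A ∘ φ_B` into steps has `φ_A = (a, 1)`,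
`0 < a ≤ 1`, and for `n ≥ 1/a`: `α_n ∘ φ_A = (n a, n) = (φ ∘ ζ') ∘ β'` with `β' = (0, n)` of Frobenius type
and the pre-step `ζ' = (n a - 1, 1)`, so the right-hand side holds and the left fails.
* `not_forall_prop41i`, `not_forall_prop41iv`, `not_forall_prop41v` — the universal closures (universe
  `0`) are FALSE.
So the three rows are admissible AT THE NAMED INSTANCES ONLY (R5): `PreFrobenioidData.prop41i_holds`
(`IsFrobenioid F`), `prop41iv_holds`, `prop41v_holds` (`IsFrobenioid F`, perf-factorial `Φ`), file
`DivisorMonoidCategoryTheoreticityProofs.lean` — untouched.  Refuted-closure ≠ refuted-paper (the paper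
speaks of Frobenioids; the missing input here is precisely Def. 1.3, e.g. the existence of arrows with
prescribed zero divisor); a FACT row is an assumption label, not an endorsement; nothing here bears on
[IUTchIII] Cor. 3.12.
-/

namespace Literature.AlgebraicGeometry.Frobenioids

open CategoryTheory

/-! ### Model A — FACT-LIST F-1038 (i), F-1042 (iv), F-1043 (v): the diagonal cone

`K = ℚ_{≥0}` realised on the diagonal of the DECLARED divisor monoid `Φ = ℚ_{≥0}²`
(`Div(a, n) = (a, a)`): the operations are of perfect and isotropic type and have steps, but NO step is
primary (`(a, a)` is never primary), while `Prime(Φ) ≠ ∅`; so the right-hand sides of (i), (iv), (v)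
hold (for (i): `α_n ∘ φ_A = (ζ' ∘? …)`; for (iv)/(v): vacuously in the primary `ε'`/`δ'`) and the
left-hand sides fail. -/

section ModelA

/-- **Model A.** One-object pre-Frobenioid data on `SingleObj F_{ℚ_{≥0}}` with DECLARED divisor monoid
`Φ = ℚ_{≥0}²`, `Div(a, n) = (a, a)`, `deg_Fr(a, n) = n`, trivial pull-backs, base `= pt`: the
Frobenius degree is the degree component, base maps are isomorphisms, `Div` vanishes exactly when the
`ℚ_{≥0}`-component does, pull-backs along endomorphisms are trivial, NO step is primary (`(a, a)`,
`a > 0`, is not primary in `ℚ_{≥0}²`) and every `Prime(Φ(·))` is non-empty (`(1, 0)` is primary).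
[cite: MochizukiFrdI2008, Def. 1.1 (iv) p.20] -/
theorem exists_prop41DiagonalConeData :
    ∃ S : PreFrobenioidData.{0} (SingleObj (ElemFrobenioidMonoid (Multiplicative ℚ≥0)))
        (Discrete PUnit.{1}),
      (∀ {X Y : SingleObj (ElemFrobenioidMonoid (Multiplicative ℚ≥0))} (f : X ⟶ Y),
          S.degFr f = (f : ElemFrobenioidMonoid (Multiplicative ℚ≥0)).degFr) ∧
      (∀ {X Y : SingleObj (ElemFrobenioidMonoid (Multiplicative ℚ≥0))} (f : X ⟶ Y),
          IsIso (S.base.map f)) ∧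
      (∀ {X Y : SingleObj (ElemFrobenioidMonoid (Multiplicative ℚ≥0))} (f : X ⟶ Y),
          S.div f = 1 ↔ (f : ElemFrobenioidMonoid (Multiplicative ℚ≥0)).div = 1) ∧
      (∀ {X : SingleObj (ElemFrobenioidMonoid (Multiplicative ℚ≥0))} (f : X ⟶ X)
          (x : S.Mon (S.base.obj X)), S.pull (S.base.map f) x = x) ∧
      (∀ {X Y : SingleObj (ElemFrobenioidMonoid (Multiplicative ℚ≥0))} (f : X ⟶ Y),
          S.IsStep f → ¬ S.IsPrimaryPreStep f) ∧
      (∀ X, Nonempty (Primes (S.Mon (S.base.obj X)))) := by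
  let j : Multiplicative ℚ≥0 →* Multiplicative (ℚ≥0 × ℚ≥0) :=
    AddMonoidHom.toMultiplicative ((AddMonoidHom.id ℚ≥0).prod (AddMonoidHom.id ℚ≥0))
  let S : PreFrobenioidData.{0} (SingleObj (ElemFrobenioidMonoid (Multiplicative ℚ≥0)))
      (Discrete PUnit.{1}) :=
    { base := (Functor.const _).obj ⟨⟨⟩⟩
      Mon := fun _ => Multiplicative (ℚ≥0 × ℚ≥0)
      pull := fun _ => MonoidHom.id _
      pull_id := fun _ _ => rfl
      pull_comp := fun _ _ _ => rfl
      div := fun f => j (f : ElemFrobenioidMonoid (Multiplicative ℚ≥0)).div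
      degFr := fun f => (f : ElemFrobenioidMonoid (Multiplicative ℚ≥0)).degFr
      div_id := fun _ => by
        rw [SingleObj.id_as_one, ElemFrobenioidMonoid.one_div, map_one]
      div_comp := fun ψ φ => by
        rw [SingleObj.comp_as_mul, ElemFrobenioidMonoid.mul_div, map_mul, map_pow]
        rfl
      degFr_id := fun _ => rfl
      degFr_comp := fun ψ φ => by
        rw [SingleObj.comp_as_mul, ElemFrobenioidMonoid.mul_degFr, mul_comm] }
  have hK : ∀ a b : ℚ≥0, a + b = 0 → b = 0 := fun a b hab => (add_eq_zero.mp hab).2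
  have hdeg : ∀ {X Y : SingleObj (ElemFrobenioidMonoid (Multiplicative ℚ≥0))} (f : X ⟶ Y),
      S.degFr f = (f : ElemFrobenioidMonoid (Multiplicative ℚ≥0)).degFr := fun _ => rfl
  have hbase : ∀ {X Y : SingleObj (ElemFrobenioidMonoid (Multiplicative ℚ≥0))} (f : X ⟶ Y),
      IsIso (S.base.map f) := fun f => by
    change IsIso (𝟙 _)
    infer_instance
  have hj : ∀ a : ℚ≥0, j (Multiplicative.ofAdd a) = Multiplicative.ofAdd (a, a) := fun _ => rfl
  have hdivj : ∀ {X Y : SingleObj (ElemFrobenioidMonoid (Multiplicative ℚ≥0))} (f : X ⟶ Y),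
      S.div f = Multiplicative.ofAdd
        (Multiplicative.toAdd (f : ElemFrobenioidMonoid (Multiplicative ℚ≥0)).div,
         Multiplicative.toAdd (f : ElemFrobenioidMonoid (Multiplicative ℚ≥0)).div) := fun f => by
    change j _ = _
    rw [← ofAdd_toAdd (ElemFrobenioidMonoid.div _), hj, toAdd_ofAdd]
  have hdiv : ∀ {X Y : SingleObj (ElemFrobenioidMonoid (Multiplicative ℚ≥0))} (f : X ⟶ Y),
      S.div f = 1 ↔ (f : ElemFrobenioidMonoid (Multiplicative ℚ≥0)).div = 1 := fun f => by
    rw [hdivj, ofAdd_eq_one, Prod.mk_eq_zero, and_self, toAdd_eq_zero]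
  refine ⟨S, hdeg, hbase, hdiv, fun _ _ => rfl, fun f hf hp => ?_,
    fun X => ⟨Quotient.mk _ ⟨_, isPrimary_ofAdd_one_zero_nnrat⟩⟩⟩
  rw [singleObj_isStep_iff S hK hdeg hbase] at hf
  have hp2 := hp.2
  rw [hdivj] at hp2
  have h0 : 0 < Multiplicative.toAdd (f : ElemFrobenioidMonoid (Multiplicative ℚ≥0)).div :=
    pos_iff_ne_zero.mpr fun h0 => hf.2 (toAdd_eq_zero.mp h0)
  exact not_isPrimary_ofAdd_nnrat_of_pos h0 h0 hp2

/-- FACT-LIST **F-1042**: the universal closure of `PreFrobenioidData.Prop41iv` (universe `0`) is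
FALSE.  Witness: Model A with `δ = ε = (1, 1)` — `δ` is a non-primary step, yet at any prime `𝔭` of
`Φ(F) = ℚ_{≥0}²` the criterion of (iv) holds vacuously (no primary step `ε'` exists).  Instance of
record (untouched): `PreFrobenioidData.prop41iv_holds` (every Frobenioid with perf-factorial `Φ`).
[cite: MochizukiFrdI2008, Prop. 4.1 (iv) p.76] -/
theorem not_forall_prop41iv :
    ¬ ∀ (C : Type) [Category.{0} C] (D : Type) [Category.{0} D] (S : PreFrobenioidData.{0} C D),
        S.Prop41iv := by
  intro h
  obtain ⟨S, hdeg, hbase, hdiv, -, hnp, hne⟩ := exists_prop41DiagonalConeData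
  have hK : ∀ a b : ℚ≥0, a + b = 0 → b = 0 := fun a b hab => (add_eq_zero.mp hab).2
  let A := SingleObj.star (ElemFrobenioidMonoid (Multiplicative ℚ≥0))
  let δ : A ⟶ A := (⟨Multiplicative.ofAdd (1 : ℚ≥0), 1⟩ : ElemFrobenioidMonoid (Multiplicative ℚ≥0))
  have hδ : S.IsStep δ := (singleObj_isStep_iff S hK hdeg hbase δ).mpr
    ⟨rfl, fun h0 => one_ne_zero (ofAdd_eq_one.mp h0)⟩
  have key := h _ _ S (singleObj_isOfPerfectType S hdeg hbase hdiv)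
    (singleObj_isOfIsotropicType S hdeg hbase hdiv) δ δ hδ hδ
  obtain ⟨𝔭⟩ := hne A
  exact hnp δ hδ (key.mpr ⟨𝔭, fun E' ε' hε' hp _ => absurd hp (hnp ε' hε')⟩)

/-- FACT-LIST **F-1043**: the universal closure of `PreFrobenioidData.Prop41v` (universe `0`) is
FALSE.  Witness: Model A with `δ = ε = (1, 1)` — `ε` is a non-primary step, yet at any prime `𝔭` of
`Φ(D') = ℚ_{≥0}²` the criterion of (v) holds vacuously (no primary step `δ'` exists).  Instance of
record (untouched): `PreFrobenioidData.prop41v_holds` (every Frobenioid with perf-factorial `Φ`).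
[cite: MochizukiFrdI2008, Prop. 4.1 (v) p.76] -/
theorem not_forall_prop41v :
    ¬ ∀ (C : Type) [Category.{0} C] (D : Type) [Category.{0} D] (S : PreFrobenioidData.{0} C D),
        S.Prop41v := by
  intro h
  obtain ⟨S, hdeg, hbase, hdiv, -, hnp, hne⟩ := exists_prop41DiagonalConeData
  have hK : ∀ a b : ℚ≥0, a + b = 0 → b = 0 := fun a b hab => (add_eq_zero.mp hab).2
  let A := SingleObj.star (ElemFrobenioidMonoid (Multiplicative ℚ≥0))
  let δ : A ⟶ A := (⟨Multiplicative.ofAdd (1 : ℚ≥0), 1⟩ : ElemFrobenioidMonoid (Multiplicative ℚ≥0))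
  have hδ : S.IsStep δ := (singleObj_isStep_iff S hK hdeg hbase δ).mpr
    ⟨rfl, fun h0 => one_ne_zero (ofAdd_eq_one.mp h0)⟩
  have key := h _ _ S (singleObj_isOfPerfectType S hdeg hbase hdiv)
    (singleObj_isOfIsotropicType S hdeg hbase hdiv) δ δ hδ hδ
  obtain ⟨𝔭⟩ := hne A
  exact hnp δ hδ (key.mpr ⟨𝔭, fun E' δ' hδ' hp _ => absurd hp (hnp δ' hδ')⟩)

/-- FACT-LIST **F-1038**: the universal closure of `PreFrobenioidData.Prop41i` (universe `0`) is
FALSE.  Witness: Model A at its object with `α_n = (0, n)` (the Prop. 4.1 setting holds) and the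
non-primary step `φ = (1, 1)`: for every factorisation `φ = φ_A ∘ φ_B` into steps, `φ_A = (a, 1)` with
`0 < a ≤ 1`, so for `n ≥ 1/a` one has `α_n ∘ φ_A = (n a, n) = (φ ∘ ζ') ∘ β'` with `β' = (0, n)` of
Frobenius type and the pre-step `ζ' = (n a - 1, 1)` — the right-hand side of (i) holds, the left fails.
Instance of record (untouched): `PreFrobenioidData.prop41i_holds` (every Frobenioid).
[cite: MochizukiFrdI2008, Prop. 4.1 (i) p.75] -/
theorem not_forall_prop41i :
    ¬ ∀ (C : Type) [Category.{0} C] (D : Type) [Category.{0} D] (S : PreFrobenioidData.{0} C D)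
        (A : C) (α : ℕ+ → End A), S.Prop41i A α := by
  intro h
  obtain ⟨S, hdeg, hbase, hdiv, hpull, hnp, -⟩ := exists_prop41DiagonalConeData
  have hK : ∀ a b : ℚ≥0, a + b = 0 → b = 0 := fun a b hab => (add_eq_zero.mp hab).2
  let A := SingleObj.star (ElemFrobenioidMonoid (Multiplicative ℚ≥0))
  obtain ⟨α, hset, hα⟩ := singleObj_exists_prop41Setting S hdeg hbase hdiv hpull A
  let φ : A ⟶ A := (⟨Multiplicative.ofAdd (1 : ℚ≥0), 1⟩ : ElemFrobenioidMonoid (Multiplicative ℚ≥0))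
  have hφ : S.IsStep φ := (singleObj_isStep_iff S hK hdeg hbase φ).mpr
    ⟨rfl, fun h0 => one_ne_zero (ofAdd_eq_one.mp h0)⟩
  refine hnp φ hφ ((h _ _ S A α hset φ hφ).mpr ?_)
  intro B' φB φA hφB hφA hcomp
  rw [singleObj_isStep_iff S hK hdeg hbase] at hφB hφA
  -- `φ_A = (a, 1)` with `0 < a ≤ 1`
  set a : ℚ≥0 := Multiplicative.toAdd (φA : ElemFrobenioidMonoid (Multiplicative ℚ≥0)).div with ha_def
  have ha : (φA : ElemFrobenioidMonoid (Multiplicative ℚ≥0)).div = Multiplicative.ofAdd a := by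
    rw [ha_def, ofAdd_toAdd]
  have ha0 : 0 < a := pos_iff_ne_zero.mpr fun h0 => hφA.2 (by rw [ha, h0, ofAdd_zero])
  have ha1 : a ≤ 1 := by
    have hv := congrArg (fun f : ElemFrobenioidMonoid (Multiplicative ℚ≥0) => Multiplicative.toAdd f.div) hcomp
    simp only [SingleObj.comp_as_mul] at hv
    calc a ≤ a + _ := le_self_add
      _ = 1 := hv
  obtain ⟨m, hm⟩ := Archimedean.arch (1 : ℚ≥0) ha0
  have hm0 : 0 < m := by
    refine Nat.pos_of_ne_zero ?_
    rintro rfl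
    rw [zero_smul] at hm
    exact not_lt.mpr hm zero_lt_one
  refine ⟨⟨m, hm0⟩, B', (⟨1, ⟨m, hm0⟩⟩ : ElemFrobenioidMonoid (Multiplicative ℚ≥0)),
    (⟨Multiplicative.ofAdd (m • a - 1), 1⟩ : ElemFrobenioidMonoid (Multiplicative ℚ≥0)),
    (singleObj_isFrobeniusType_iff S hdeg hbase hdiv _).mpr rfl,
    (singleObj_isPreStep_iff S hdeg hbase _).mpr rfl, ?_⟩
  have hφdiv : (φ : ElemFrobenioidMonoid (Multiplicative ℚ≥0)).div = Multiplicative.ofAdd (1 : ℚ≥0) :=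
    rfl
  have hφdeg : (φ : ElemFrobenioidMonoid (Multiplicative ℚ≥0)).degFr = 1 := rfl
  refine ElemFrobenioidMonoid.ext ?_ ?_
  · apply Multiplicative.toAdd.injective
    simp only [singleObj_comp_div, singleObj_comp_degFr, hα, hφdiv, hφdeg, ha, PNat.mk_coe,
      PNat.one_coe, pow_one, mul_one, one_mul, toAdd_mul, toAdd_pow, toAdd_ofAdd]
    rw [add_tsub_cancel_of_le hm]
  · simp only [singleObj_comp_degFr, hα, hφdeg, hφA.1, mul_one, one_mul]

end ModelA

end Literature.AlgebraicGeometry.Frobenioids
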